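import Literature.NumberTheory.DiophantineGeometry.GenEllPrimeSelection
import Literature.NumberTheory.DiophantineGeometry.GenEllLAdicImageSurjective
import Literature.NumberTheory.DiophantineGeometry.GenEllMellProofs
import Mathlib.Analysis.Normed.Module.RCLike.Real
import HarnessLib

/-!
# [GenEll] Corollaries 4.3 and 4.4 (full Galois actions) from Theorem 3.8

Topic `NumberTheory/DiophantineGeometry`.  Theorem-only file (no definition, no named fact): the
proofs of [GenEll] Cor. 4.3 ("Full Galois Actions for Degenerating Elliptic Curves") and Cor. 4.4
("Full Galois Actions for Compactly Bounded Subsets"), pp. 22–23, from the named fact `GenEll_thm38`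
([GenEll] Thm. 3.8, `GenEllFullGalois.lean`) exactly as printed ("Thus, by applying Theorem 3.8 … it
suffices to show the existence of prime numbers `l°`, `l•` that satisfy the conditions (a), (c), and,
moreover, are `≥ 23040 · 100d · (ht^Falt([E_L]) + C′ · d^ε)`"), the rest being unconditional:
Prop. 3.4 (`prop34Ineq_of_pos`), Lemma 4.1 in absolute form and the `x_{S°}` / `x_{S•}` estimates
(`GenEllPrimeSelection.lean`).

* `cor43_pair` — Cor. 4.3 with conditions (a), (c) verbatim and (b) in the form Theorem 3.8 delivers
  it for BOTH primes: `SL₂`-containment of the image in `Aut(E[l^n])` for every `n ≥ 1`;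
* `cor44_pair` — Cor. 4.4 likewise (Theorem 3.8 (b) with `l ≥ 7`, so `l` is prime to `30`; Lemma 4.1
  with `h = 7`);
* `GenEll_cor43_of_thm38`, `GenEll_cor44_of_thm38` — the named facts `GenEll_cor43`, `GenEll_cor44`
  of `GenEllPrimesPrescribed.lean` from `GenEll_thm38` ALONE; the surjectivity clause for `l•` is
  print's bracketed "well-known fact" ("if `l` is any prime number that is unramified in `L`, then the
  image … contains `SL₂(ℤ_l)` if and only if the Galois representation … is surjective", p. 22),
  PROVED in `GenEllLAdicImageSurjective.lean` (`EllPoint.lAdicImageSurjective_of_containsSL2`).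

Rendering notes. (1) The hypothesis "`L` is a minimal field of definition" of print is not needed for
(a)–(c) and is not used. (2) `6d · log-diff_{M_ell}([E_L]) = 6 · log |d_L|`. (3) The Faltings height may
be negative; the constant `C` absorbs this through the lower bound `ht^Falt ≥ −C″` implied by Prop. 3.4
(`0 ≤ ht_∞ ≤ 12(1 + 1/5) · ht^Falt + C″`).

## References

* S. Mochizuki, *Arithmetic elliptic curves in general position*, Math. J. Okayama Univ. 52
  (2010), Cor. 4.3, Cor. 4.4, pp. 22–23. [MochizukiGenEll2010]
-/

noncomputable section

open NumberField Ideal IsDedekindDomain Finset Metric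

namespace Literature.NumberTheory.DiophantineGeometry.GenEll

/-! ## Plumbing -/

/-- There is a compactly bounded subset of `M_ell(Q̄)` (support `V = {∞}`, `K_∞` the closed unit
disc). [folklore] -/
private theorem nonempty_mellCBData : Nonempty MellCBData := by
  refine ⟨{ primes := ∅
            primes_prime := by simp
            Karc := closedBall 0 1
            Knon := fun _ _ => Set.univ
            Karc_nonempty := ⟨0, by simp⟩
            Karc_isCompact := isCompact_closedBall 0 1
            Karc_closure_interior := by
              rw [interior_closedBall (0 : ℂ) one_ne_zero, closure_ball (0 : ℂ) one_ne_zero]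
            Karc_conj := by
              intro z hz
              rw [mem_closedBall, dist_zero_right] at hz ⊢
              rwa [Complex.norm_conj]
            Knon_nonempty := by intro p hp; simp at hp
            Knon_galois := by intro p hp; simp at hp
            Knon_compactDomain := by intro p hp; simp at hp }⟩

/-- `ht_∞ ≥ 0`. [folklore] -/
private theorem htInf_nonneg (P : EllPoint) : 0 ≤ P.htInf := by
  unfold EllPoint.htInf
  exact mul_nonneg (inv_nonneg.mpr (by positivity)) (Height.zero_le_logHeight₁ _)

/-- Prop. 3.4 with `1 + ε = 6/5`: a constant `C″ ≥ 0` with `d · deg_∞ ≤ d · (14.4 · ht^Falt + C″)`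
and `ht^Falt ≥ −C″` for every presented elliptic curve. [cite: MochizukiGenEll2010, Prop 3.4 p.17] -/
private theorem exists_prop34_constant :
    ∃ C'' : ℝ, 0 ≤ C'' ∧ ∀ P : EllPoint,
      (P.degree : ℝ) * P.degInf ≤ (P.degree : ℝ) * (72 / 5 * P.htFalt + C'') ∧ -C'' ≤ P.htFalt := by
  obtain ⟨C, hC⟩ := (prop34Ineq_of_pos (show (0 : ℝ) < 1 / 5 by norm_num)).2.1
  refine ⟨|C|, abs_nonneg _, fun P => ?_⟩
  have h1 : P.htInf - 12 * (1 + 1 / 5) * P.htFalt ≤ C := hC P (Set.mem_univ _)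
  have h2 := htInf_nonneg P
  have h3 := P.degInf_le_htInf
  have h4 := le_abs_self C
  have hd : (0 : ℝ) ≤ P.degree := by positivity
  refine ⟨mul_le_mul_of_nonneg_left (by linarith) hd, ?_⟩
  have h5 : 0 ≤ |C| := abs_nonneg _
  nlinarith

/-- Coefficient absorption: `a·X ≤ K·X + (K - a)·M·d` when `X ≥ -M·d`, `a ≤ K`. [folklore] -/
private theorem absorb {a K X M d : ℝ} (haK : a ≤ K) (hX : -(M * d) ≤ X) :
    a * X ≤ K * X + (K - a) * (M * d) := by nlinarith

/-- A prime `≥ 7` is prime to `30`. [folklore] -/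
private theorem coprime_thirty_of_seven_le {l : ℕ} (hl : l.Prime) (h7 : 7 ≤ l) : Nat.Coprime l 30 := by
  rw [Nat.Prime.coprime_iff_not_dvd hl]
  intro hdvd
  have h' : l ∣ 2 * 3 * 5 := by norm_num; exact hdvd
  rcases (Nat.Prime.dvd_mul hl).mp h' with h | h
  · rcases (Nat.Prime.dvd_mul hl).mp h with h | h
    · have := Nat.le_of_dvd (by norm_num) h; omega
    · have := Nat.le_of_dvd (by norm_num) h; omega
  · have := Nat.le_of_dvd (by norm_num) h; omega

/-! ## Corollary 4.3 -/

/-- **[GenEll] Corollary 4.3** (from Theorem 3.8): for every `ε > 0` there are `C > 0` and a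
Galois-finite `Exc` such that for every presented elliptic curve `E/L` with `[E_L] ∉ Exc` having a
prime of potentially multiplicative reduction and every finite `S ⊆ ℕ`, there are primes `l°, l• ∉ S`
with (a) both prime to the primes of potentially multiplicative reduction and to the local heights of
`E_L`, `l•` moreover prime to `d_L` and to all ramification indices of `L/ℚ`; (b) for both, the image
of `Gal(Q̄/L)` in `Aut(E[l^n])` contains `SL₂` for every `n ≥ 1` (what Theorem 3.8 (a) gives); (c)
`l° ≤ 23040 · 900 d · ht^Falt + 2 x_S + C · d^{1+ε}` and
`l• ≤ 23040 · 900 d · ht^Falt + 6 · log |d_L| + 2 x_S + C · d^{1+ε}`.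
[cite: MochizukiGenEll2010, Cor 4.3 p.22] -/
theorem cor43_pair (h38 : GenEll_thm38) {ε : ℝ} (hε : 0 < ε) :
    ∃ C : ℝ, 0 < C ∧ ∃ Exc : Set (Polynomial ℚ), MellExcGaloisFinite Exc ∧
      ∀ (P : EllPoint), ¬ MellExcMem Exc P → P.HasPotMultPlace → ∀ S : Finset ℕ,
        ∃ (lo lb : ℕ) (_ : Fact lo.Prime) (_ : Fact lb.Prime), lo ∉ S ∧ lb ∉ S ∧
          (∀ v : HeightOneSpectrum (𝓞 P.F), P.IsPotMult v →
              (lo : 𝓞 P.F) ∉ v.asIdeal ∧ ¬ ((lo : ℤ) ∣ P.localHeight v)) ∧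
          (∀ v : HeightOneSpectrum (𝓞 P.F), P.IsPotMult v →
              (lb : 𝓞 P.F) ∉ v.asIdeal ∧ ¬ ((lb : ℤ) ∣ P.localHeight v)) ∧
          ¬ ((lb : ℤ) ∣ discr P.F) ∧
          (∀ v : HeightOneSpectrum (𝓞 P.F), ¬ (lb ∣ v.asIdeal.ramificationIdx ℤ)) ∧
          (∀ n : ℕ, 0 < n → P.ImageModLContainsSL2 (lo ^ n)) ∧
          (∀ n : ℕ, 0 < n → P.ImageModLContainsSL2 (lb ^ n)) ∧
          (lo : ℝ) ≤ 23040 * 900 * (P.degree : ℝ) * P.htFalt + 2 * (∑ p ∈ S, Real.log (p : ℝ)) +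
            C * (P.degree : ℝ) ^ (1 + ε) ∧
          (lb : ℝ) ≤ 23040 * 900 * (P.degree : ℝ) * P.htFalt +
            6 * Real.log ((discr P.F).natAbs : ℝ) + 2 * (∑ p ∈ S, Real.log (p : ℝ)) +
            C * (P.degree : ℝ) ^ (1 + ε) := by
  classical
  obtain ⟨D₀⟩ := nonempty_mellCBData
  obtain ⟨C, hC, Exc, hExc, H38⟩ := h38 D₀ ε hε
  obtain ⟨C'', hC'', H34⟩ := exists_prop34_constant
  obtain ⟨C₁, hC₁, H41⟩ := exists_prime_avoiding_potMult
  obtain ⟨C₂, hC₂, H42⟩ := exists_prime_avoiding_potMult_ramification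
  refine ⟨8 * (23040 * 100) * C + 21000000 * C'' + C₁ + C₂ + 1, by positivity, Exc, hExc,
    fun P hExcP hpot S => ?_⟩
  set d : ℝ := (P.degree : ℝ) with hd_def
  have hd1 : (1 : ℝ) ≤ d := by rw [hd_def]; exact_mod_cast P.degree_pos
  set h : ℝ := 23040 * 100 * d * (P.htFalt + C * d ^ ε) with hh_def
  obtain ⟨lo, hlo, hloS, hhlo, hpoto, hleo⟩ := H41 P S (max h 0) (le_max_right _ _)
  obtain ⟨lb, hlb, hlbS, hhlb, hpotb, hdiscb, hramb, hleb⟩ := H42 P S (max h 0) (le_max_right _ _)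
  haveI : Fact lo.Prime := ⟨hlo⟩
  haveI : Fact lb.Prime := ⟨hlb⟩
  refine ⟨lo, lb, ‹_›, ‹_›, hloS, hlbS, hpoto, hpotb, hdiscb, hramb,
    fun n hn => H38 P lo hExcP (Or.inl ⟨(le_max_left _ _).trans hhlo, hpot⟩) n hn,
    fun n hn => H38 P lb hExcP (Or.inl ⟨(le_max_left _ _).trans hhlb, hpot⟩) n hn, ?_⟩
  -- (c): arithmetic
  obtain ⟨hdI, hF⟩ := H34 P
  have hdε : 1 ≤ d ^ ε := Real.one_le_rpow hd1 hε.le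
  have hsplit : d ^ (1 + ε) = d * d ^ ε := by
    rw [Real.rpow_add (by linarith : (0 : ℝ) < d), Real.rpow_one]
  have hd1ε : d ≤ d ^ (1 + ε) := by
    rw [hsplit]; exact le_mul_of_one_le_right (by linarith) hdε
  have hX : -(C'' * d) ≤ d * P.htFalt := by nlinarith
  have hZ1 : (1 : ℝ) ≤ d ^ (1 + ε) := hd1.trans hd1ε
  have hCZ : 0 ≤ C * d ^ (1 + ε) := by positivity
  have hC''Z : C'' * d ≤ C'' * d ^ (1 + ε) := mul_le_mul_of_nonneg_left hd1ε hC''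
  have hC₁Z : C₁ ≤ C₁ * d ^ (1 + ε) := le_mul_of_one_le_right hC₁ hZ1
  have hC₂Z : C₂ ≤ C₂ * d ^ (1 + ε) := le_mul_of_one_le_right hC₂ hZ1
  rcases le_or_gt 0 h with hh0 | hh0
  · rw [max_eq_left hh0] at hleo hleb
    have key := absorb (show (72 + 8 * (23040 * 100) : ℝ) ≤ 23040 * 900 by norm_num) hX
    have h8 : 8 * h = 8 * (23040 * 100) * (d * P.htFalt) + 8 * (23040 * 100) * C * d ^ (1 + ε) := by
      rw [hh_def, hsplit]; ring
    constructor <;> nlinarith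
  · rw [max_eq_right hh0.le] at hleo hleb
    have key := absorb (show (72 : ℝ) ≤ 23040 * 900 by norm_num) hX
    constructor <;> nlinarith

/-! ## Corollary 4.4 -/

/-- **[GenEll] Corollary 4.4** (from Theorem 3.8): for every compactly bounded `K_V ⊆ M_ell(Q̄)` there
are `C > 0` and a Galois-finite `Exc` such that for every presented elliptic curve `E/L` with
`[E_L] ∈ K_V`, `[E_L] ∉ Exc`, and every finite `S ⊆ ℕ`, there are primes `l°, l• ∉ S` with (a) as in
Cor. 4.3, (b) `SL₂`-containment of the Galois image at every level for both (Theorem 3.8 (b), the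
primes being chosen `≥ 7`, hence prime to `30`), and (c) `l° ≤ 23040 · 100 d · ht^Falt + 2 x_S + C · d`,
`l• ≤ 23040 · 100 d · ht^Falt + 6 · log |d_L| + 2 x_S + C · d`.
[cite: MochizukiGenEll2010, Cor 4.4 p.23] -/
theorem cor44_pair (h38 : GenEll_thm38) (D : MellCBData) :
    ∃ C : ℝ, 0 < C ∧ ∃ Exc : Set (Polynomial ℚ), MellExcGaloisFinite Exc ∧
      ∀ (P : EllPoint), D.Mem P → ¬ MellExcMem Exc P → ∀ S : Finset ℕ,
        ∃ (lo lb : ℕ) (_ : Fact lo.Prime) (_ : Fact lb.Prime), lo ∉ S ∧ lb ∉ S ∧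
          (∀ v : HeightOneSpectrum (𝓞 P.F), P.IsPotMult v →
              (lo : 𝓞 P.F) ∉ v.asIdeal ∧ ¬ ((lo : ℤ) ∣ P.localHeight v)) ∧
          (∀ v : HeightOneSpectrum (𝓞 P.F), P.IsPotMult v →
              (lb : 𝓞 P.F) ∉ v.asIdeal ∧ ¬ ((lb : ℤ) ∣ P.localHeight v)) ∧
          ¬ ((lb : ℤ) ∣ discr P.F) ∧
          (∀ v : HeightOneSpectrum (𝓞 P.F), ¬ (lb ∣ v.asIdeal.ramificationIdx ℤ)) ∧
          (∀ n : ℕ, 0 < n → P.ImageModLContainsSL2 (lo ^ n)) ∧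
          (∀ n : ℕ, 0 < n → P.ImageModLContainsSL2 (lb ^ n)) ∧
          (lo : ℝ) ≤ 23040 * 100 * (P.degree : ℝ) * P.htFalt + 2 * (∑ p ∈ S, Real.log (p : ℝ)) +
            C * (P.degree : ℝ) ∧
          (lb : ℝ) ≤ 23040 * 100 * (P.degree : ℝ) * P.htFalt +
            6 * Real.log ((discr P.F).natAbs : ℝ) + 2 * (∑ p ∈ S, Real.log (p : ℝ)) +
            C * (P.degree : ℝ) := by
  classical
  obtain ⟨C, -, Exc, hExc, H38⟩ := h38 D 1 one_pos
  obtain ⟨C'', hC'', H34⟩ := exists_prop34_constant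
  obtain ⟨C₁, hC₁, H41⟩ := exists_prime_avoiding_potMult
  obtain ⟨C₂, hC₂, H42⟩ := exists_prime_avoiding_potMult_ramification
  refine ⟨2400000 * C'' + C₁ + C₂ + 57, by positivity, Exc, hExc, fun P hmem hExcP S => ?_⟩
  set d : ℝ := (P.degree : ℝ) with hd_def
  have hd1 : (1 : ℝ) ≤ d := by rw [hd_def]; exact_mod_cast P.degree_pos
  obtain ⟨lo, hlo, hloS, hhlo, hpoto, hleo⟩ := H41 P S 7 (by norm_num)
  obtain ⟨lb, hlb, hlbS, hhlb, hpotb, hdiscb, hramb, hleb⟩ := H42 P S 7 (by norm_num)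
  haveI : Fact lo.Prime := ⟨hlo⟩
  haveI : Fact lb.Prime := ⟨hlb⟩
  have h7o : 7 ≤ lo := by exact_mod_cast hhlo
  have h7b : 7 ≤ lb := by exact_mod_cast hhlb
  refine ⟨lo, lb, ‹_›, ‹_›, hloS, hlbS, hpoto, hpotb, hdiscb, hramb,
    fun n hn => H38 P lo hExcP
      (Or.inr ⟨hmem, fun v hv => (hpoto v hv).2, coprime_thirty_of_seven_le hlo h7o⟩) n hn,
    fun n hn => H38 P lb hExcP
      (Or.inr ⟨hmem, fun v hv => (hpotb v hv).2, coprime_thirty_of_seven_le hlb h7b⟩) n hn, ?_⟩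
  obtain ⟨hdI, hF⟩ := H34 P
  have hX : -(C'' * d) ≤ d * P.htFalt := by nlinarith
  have key := absorb (show (72 : ℝ) ≤ 23040 * 100 by norm_num) hX
  have hC''d : C'' ≤ C'' * d := le_mul_of_one_le_right hC'' hd1
  have hC₁d : C₁ ≤ C₁ * d := le_mul_of_one_le_right hC₁ hd1
  have hC₂d : C₂ ≤ C₂ * d := le_mul_of_one_le_right hC₂ hd1
  constructor <;> nlinarith

/-! ## The named facts `GenEll_cor43`, `GenEll_cor44` of `GenEllPrimesPrescribed.lean` -/

/-- `l ∉ v` for the pot. mult. primes (our form of (a)) gives `l ≠ p_v` (`GenEll.EllPoint.PrimeToPotMultData`).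
[cite: MochizukiGenEll2010, Cor 4.3 (a) p.22] -/
theorem EllPoint.primeToPotMultData_of (P : EllPoint) (l : ℕ)
    (h : ∀ v : HeightOneSpectrum (𝓞 P.F), P.IsPotMult v →
      (l : 𝓞 P.F) ∉ v.asIdeal ∧ ¬ ((l : ℤ) ∣ P.localHeight v)) :
    P.PrimeToPotMultData l := by
  intro v hv
  refine ⟨?_, (h v hv).2⟩
  intro hl
  apply (h v hv).1
  have hmem : ((Literature.IUT.LogVolume.residueChar P.F v : ℤ)) ∈
      Ideal.span {(Literature.IUT.LogVolume.residueChar P.F v : ℤ)} := Ideal.mem_span_singleton_self _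
  rw [Ideal.mem_of_liesOver v.asIdeal, map_natCast] at hmem
  rw [hl]
  exact hmem

/-- `l ∤ d_L` and `l ∤ e_v` (Mathlib's `Ideal.ramificationIdx`) give `GenEll.EllPoint.PrimeToRamificationData`
(the tree's `ramIdx`, an `Ideal.ramificationIdx'`). [cite: MochizukiGenEll2010, Cor 4.3 (a) p.22] -/
theorem EllPoint.primeToRamificationData_of (P : EllPoint) (l : ℕ) (hdisc : ¬ ((l : ℤ) ∣ discr P.F))
    (hram : ∀ v : HeightOneSpectrum (𝓞 P.F), ¬ (l ∣ v.asIdeal.ramificationIdx ℤ)) :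
    P.PrimeToRamificationData l := by
  refine ⟨hdisc, fun v => ?_⟩
  haveI : v.asIdeal.IsPrime := v.isPrime
  have hp : Ideal.span {(Literature.IUT.LogVolume.residueChar P.F v : ℤ)} ≠ ⊥ := by
    rw [Ne, Ideal.span_singleton_eq_bot]
    exact_mod_cast (Literature.IUT.LogVolume.residueChar_prime P.F v).ne_zero
  unfold Literature.IUT.LogVolume.ramIdx
  rw [Ideal.ramificationIdx'_eq_ramificationIdx _ v.asIdeal hp]
  exact hram v

/-- **[GenEll] Corollary 4.3 as typed (`GenEll_cor43`) from Theorem 3.8** (the surjectivity for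
`l•` by `EllPoint.lAdicImageSurjective_of_containsSL2`, print's "if `l` is any prime number that is
unramified in `L`, then the image … contains `SL₂(ℤ_l)` if and only if … is surjective").
[cite: MochizukiGenEll2010, Cor 4.3 p.22] -/
theorem GenEll_cor43_of_thm38 (h38 : GenEll_thm38) : GenEll_cor43 := by
  intro ε hε
  obtain ⟨C, hC, Exc, hExc, H⟩ := cor43_pair h38 hε
  refine ⟨C, hC, Exc, hExc, fun P S _ _ hExcP hpot => ?_⟩
  obtain ⟨lo, lb, ilo, ilb, hloS, hlbS, hpoto, hpotb, hdiscb, hramb, hSLo, hSLb, hleo, hleb⟩ :=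
    H P hExcP hpot S
  have hramD := P.primeToRamificationData_of lb hdiscb hramb
  have hSLb' : P.LAdicImageContainsSL2 lb := fun n hn => hSLb n hn
  refine ⟨lo, lb, ilo, ilb, hloS, hlbS, P.primeToPotMultData_of lo hpoto,
    P.primeToPotMultData_of lb hpotb, hramD, fun n hn => hSLo n hn,
    P.lAdicImageSurjective_of_containsSL2 lb hramD hSLb', ?_, ?_⟩
  · simpa [thetaFinset] using hleo
  · have hd : (P.degree : ℝ) ≠ 0 := by exact_mod_cast P.degree_pos.ne'
    have : 6 * (P.degree : ℝ) * P.logDiffMell = 6 * Real.log ((discr P.F).natAbs : ℝ) := by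
      unfold EllPoint.logDiffMell; field_simp
    rw [this]
    simpa [thetaFinset] using hleb

/-- **[GenEll] Corollary 4.4 as typed (`GenEll_cor44`) from Theorem 3.8** (surjectivity for `l•` by
`EllPoint.lAdicImageSurjective_of_containsSL2`). [cite: MochizukiGenEll2010, Cor 4.4 p.23] -/
theorem GenEll_cor44_of_thm38 (h38 : GenEll_thm38) : GenEll_cor44 := by
  intro D
  obtain ⟨C, hC, Exc, hExc, H⟩ := cor44_pair h38 D
  refine ⟨C, hC, Exc, hExc, fun P S _ _ hmem hExcP => ?_⟩
  obtain ⟨lo, lb, ilo, ilb, hloS, hlbS, hpoto, hpotb, hdiscb, hramb, hSLo, hSLb, hleo, hleb⟩ :=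
    H P hmem hExcP S
  have hramD := P.primeToRamificationData_of lb hdiscb hramb
  have hSLb' : P.LAdicImageContainsSL2 lb := fun n hn => hSLb n hn
  refine ⟨lo, lb, ilo, ilb, hloS, hlbS, P.primeToPotMultData_of lo hpoto,
    P.primeToPotMultData_of lb hpotb, hramD, fun n hn => hSLo n hn,
    P.lAdicImageSurjective_of_containsSL2 lb hramD hSLb', ?_, ?_⟩
  · simpa [thetaFinset] using hleo
  · have hd : (P.degree : ℝ) ≠ 0 := by exact_mod_cast P.degree_pos.ne'
    have : 6 * (P.degree : ℝ) * P.logDiffMell = 6 * Real.log ((discr P.F).natAbs : ℝ) := by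
      unfold EllPoint.logDiffMell; field_simp
    rw [this]
    simpa [thetaFinset] using hleb

end Literature.NumberTheory.DiophantineGeometry.GenEll
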